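import Summits.KontsevichZagierPeriods.KontsevichZagierPeriods.Theorems.MzvKernelInKZ.Negative.CalabiTwo
import Summits.KontsevichZagierPeriods.KontsevichZagierPeriods.Theorems.MzvKernelInKZ.Negative.ScalingDivision
import Summits.KontsevichZagierPeriods.KontsevichZagierPeriods.Theorems.MzvKernelInKZ.Negative.WeightsTwoThree

/-!
# `MzvKernelInKZ` (stmt-KontsevichZagierPeriods-3914): negative side — Euler’s `ζ(2) = π²/6` inside the calculus: `3·[Δ₂, ω₀₁] ≡ 2·Q²`

Companion of `Negative/CalabiTwo.lean` and `Negative/ScalingDivision.lean`.  The `ζ(2)` side of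
Beukers–Kolk–Calabi, move by move: the cubical chart of `Δ₂` (`C2cube_sub_mem_cov`), the split
`1/(1−xy) = 1/(1−x²y²) + xy/(1−x²y²)` (rule (1b), `C2cube_split_mem`), the squaring map
`(x,y) ↦ (x²,y²)` carrying the even part onto `¼·[□², 1/(1−xy)]` (rule (2), `M2rep_sub_C2q_mem_cov`),
and `4·[□², ¼f] ≡ [□², f]` (scaling); with `CalabiTwo.lean`:
**`3 • [Δ₂, ω₀₁] − 2 • [Q²] ∈ KZ.relations`** (`three_zeta_two_sub_two_G2_mem`).

Sources: F. Beukers, J. A. C. Kolk, E. Calabi, *Sums of generalized harmonic series and volumes*, Nieuw Arch. Wisk. (4) 11 (1993), 217–224; M. Kontsevich, D. Zagier, *Periods* (2001), §1.2.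
-/

noncomputable section

namespace Summit.KontsevichZagierPeriods.MzvKernelInKZ.Negative

open Set MeasureTheory MvPolynomial
open Literature.NumberTheory.Transcendental
open Literature.ModelTheory.ExponentialFields (IsSemialgebraic)

/-- Membership in `Δ₂`, coordinatewise. [folklore] -/
theorem mem_simplex_two'' {t : Fin 2 → ℝ} :
    t ∈ simplex 2 ↔ 0 < t 0 ∧ 0 < t 1 ∧ t 0 < 1 ∧ t 1 < 1 ∧ t 1 < t 0 := by
  simp only [simplex, mem_setOf_eq, Fin.forall_fin_two, Fin.strictAnti_iff_succ_lt,
    Fin.forall_fin_one]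
  constructor
  · rintro ⟨⟨a, b⟩, ⟨c, d⟩, e⟩
    exact ⟨a, b, c, d, by simpa using e⟩
  · rintro ⟨a, b, c, d, e⟩
    exact ⟨⟨a, b⟩, ⟨c, d⟩, by simpa using e⟩

/-- The cubical chart of `Δ₂`. [folklore] -/
def cub2 (x : Fin 2 → ℝ) : Fin 2 → ℝ := ![x 0, x 0 * x 1]

/-- Its derivative (Jacobian `!![1, 0; x₁, x₀]`, determinant `x₀`). [folklore] -/
def cub2Deriv (x : Fin 2 → ℝ) : (Fin 2 → ℝ) →L[ℝ] (Fin 2 → ℝ) :=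
  LinearMap.toContinuousLinearMap (Matrix.toLin' !![1, 0; x 1, x 0])

/-- The determinant of `cub2Deriv`. [folklore] -/
theorem det_cub2Deriv (x : Fin 2 → ℝ) : (cub2Deriv x).det = x 0 := by
  have h : (!![1, 0; x 1, x 0] : Matrix (Fin 2) (Fin 2) ℝ).det = x 0 := by simp [Matrix.det_fin_two]
  rw [← h]; exact LinearMap.det_toLin' _

/-- Differentiability of `cub2` with the stated derivative. [folklore] -/
theorem hasFDerivAt_cub2 (x : Fin 2 → ℝ) : HasFDerivAt cub2 (cub2Deriv x) x := by
  have p0 : HasFDerivAt (fun y : Fin 2 → ℝ => y 0)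
      (ContinuousLinearMap.proj (R := ℝ) (φ := fun _ : Fin 2 => ℝ) 0) x := hasFDerivAt_apply 0 x
  have p1 : HasFDerivAt (fun y : Fin 2 → ℝ => y 1)
      (ContinuousLinearMap.proj (R := ℝ) (φ := fun _ : Fin 2 => ℝ) 1) x := hasFDerivAt_apply 1 x
  have c0 : HasFDerivAt (fun y : Fin 2 → ℝ => cub2 y 0) ((ContinuousLinearMap.proj 0).comp (cub2Deriv x)) x := by
    refine p0.congr_fderiv ?_
    ext v; simp [cub2Deriv, dotProduct, Fin.sum_univ_two]
  have c1 : HasFDerivAt (fun y : Fin 2 → ℝ => cub2 y 1) ((ContinuousLinearMap.proj 1).comp (cub2Deriv x)) x := by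
    refine (p0.mul p1).congr_fderiv ?_
    ext v; simp [cub2Deriv, dotProduct, Fin.sum_univ_two]; ring
  rw [hasFDerivAt_pi']
  intro i; fin_cases i
  · exact c0
  · exact c1

/-- `cub2` is injective on its domain. [folklore] -/
theorem injOn_cub2 : InjOn cub2 cube2 := by
  intro x hx y hy h
  obtain ⟨⟨a0, -⟩, -⟩ := mem_cube2.mp hy
  have e0 : x 0 = y 0 := by simpa [cub2] using congrFun h 0
  have e1' : x 0 * x 1 = y 0 * y 1 := by simpa [cub2] using congrFun h 1
  rw [e0] at e1'
  have e1 : x 1 = y 1 := mul_left_cancel₀ a0.ne' e1'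
  funext i; fin_cases i
  · exact e0
  · exact e1

/-- The image of the domain under `cub2`. [folklore] -/
theorem image_cub2 : cub2 '' cube2 = simplex 2 := by
  apply Subset.antisymm
  · rintro _ ⟨x, hx, rfl⟩
    obtain ⟨⟨a0, a1⟩, ⟨b0, b1⟩⟩ := mem_cube2.mp hx
    rw [mem_simplex_two'']
    simp only [cub2, Matrix.cons_val_zero, Matrix.cons_val_one]
    exact ⟨a0, mul_pos a0 b0, a1, mul_lt_one_of_nonneg_of_lt_one_left a0.le a1 b1.le, mul_lt_of_lt_one_right a0 b1⟩
  · intro t ht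
    obtain ⟨p0, p1, l0, -, d⟩ := mem_simplex_two''.mp ht
    refine ⟨![t 0, t 1 / t 0], ?_, ?_⟩
    · rw [mem_cube2]
      simp only [Matrix.cons_val_zero, Matrix.cons_val_one]
      exact ⟨⟨p0, l0⟩, div_pos p1 p0, (div_lt_one p0).mpr d⟩
    · funext i; fin_cases i
      · simp [cub2]
      · simp [cub2]; field_simp

/-- `cub2` is a `ℚ`-semialgebraic map on its domain (rational or polynomial components). [folklore] -/
theorem isSemialgebraicMapOn_cub2 : IsSemialgebraicMapOn ℚ cube2 cub2 := by
  have h := isSemialgebraicMapOn_aeval (isSemialgebraic_openUnitCube (d := 2))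
    (![X 0, X 0 * X 1] : Fin 2 → MvPolynomial (Fin 2) ℚ)
  refine h.congr fun x _ => ?_
  funext j; fin_cases j <;> simp [cub2]

/-- The integrand of `ζ(2)` on the square: `1/(1 − xy)`. [folklore] -/
def fC2 (x : Fin 2 → ℝ) : ℝ := 1 / (1 - x 0 * x 1)

/-- Elementary bounds on the open square. [folklore] -/
theorem cube2_facts {x : Fin 2 → ℝ} (hx : x ∈ cube2) :
    0 < x 0 ∧ x 0 < 1 ∧ 0 < x 1 ∧ x 1 < 1 ∧ x 0 * x 1 < 1 ∧ x 0 ^ 2 * x 1 ^ 2 < 1 := by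
  obtain ⟨⟨a0, a1⟩, ⟨b0, b1⟩⟩ := mem_cube2.mp hx
  have p := mul_lt_one_of_nonneg_of_lt_one_left a0.le a1 b1.le
  refine ⟨a0, a1, b0, b1, p, ?_⟩
  nlinarith [mul_pos a0 b0]

/-- PULLBACK IDENTITY for `ζ(2)` under the cubical chart of `Δ₂`. [folklore] -/
theorem fC2_eq {x : Fin 2 → ℝ} (hx : x ∈ cube2) : fC2 x = wordFun ω2 1 (cub2 x) * |(cub2Deriv x).det| := by
  obtain ⟨a0, -, b0, -, p, -⟩ := cube2_facts hx
  rw [det_cub2Deriv, abs_of_pos a0]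
  simp only [wordFun, ω2, fC2, cub2, Fin.prod_univ_two, Matrix.cons_val_zero, Matrix.cons_val_one]
  simp
  have : (1 : ℝ) - x 0 * x 1 ≠ 0 := by linarith
  field_simp

/-- `fC2` is a `ℚ`-semialgebraic function on its domain. [folklore] -/
theorem isSemialgebraicFunOn_fC2 : IsSemialgebraicFunOn ℚ cube2 fC2 := by
  refine (isSemialgebraicFunOn_aeval_div_aeval (isSemialgebraic_openUnitCube (d := 2))
    (1 : MvPolynomial (Fin 2) ℚ) (1 - X 0 * X 1) fun x hx => ?_).congr fun x _ => ?_
  · obtain ⟨-, -, -, -, p, -⟩ := cube2_facts hx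
    simp only [map_sub, map_one, map_mul, aeval_X]; linarith
  · simp [fC2]

/-- Auxiliary lemma `measurableSet_cube2` (see the module docstring). [folklore] -/
theorem measurableSet_cube2 : MeasurableSet cube2 := (isOpen_openUnitCube (d := 2)).measurableSet

/-- Integrability of `fC2` on its domain. [folklore] -/
theorem integrableOn_fC2 : IntegrableOn fC2 cube2 volume := by
  have h := (integrableOn_image_iff_integrableOn_abs_det_fderiv_smul volume measurableSet_cube2
    (fun x _ => (hasFDerivAt_cub2 x).hasFDerivWithinAt) injOn_cub2 (wordFun ω2 1)).mp
    (by rw [image_cub2]; exact integrableOn_wordFun adm_ω2 1)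
  refine h.congr_fun (fun x hx => ?_) measurableSet_cube2
  dsimp only
  rw [smul_eq_mul, mul_comm, ← fC2_eq hx]

/-- `[□², 1/(1−xy)]`, the cube representation of `ζ(2)`. [folklore] -/
def C2cube : KZ.IntegralRep 2 :=
  ⟨cube2, fC2, isSemialgebraic_openUnitCube, isSemialgebraicFunOn_fC2, integrableOn_fC2⟩

/-- One change of variables to the simplex word representation of `ζ(2)`. [folklore] -/
theorem C2cube_sub_mem_cov : KZ.of C2cube - KZ.of (wordRep ω2 1 adm_ω2) ∈ KZ.changeOfVariablesRel :=
  ⟨2, C2cube, wordRep ω2 1 adm_ω2, cub2, fun x => cub2Deriv x, isSemialgebraicMapOn_cub2,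
    fun x _ => (hasFDerivAt_cub2 x).hasFDerivWithinAt, injOn_cub2, image_cub2.symm, fun _ hx => fC2_eq hx, rfl⟩

/-- `[□², xy/(1−x²y²)] = [□², 1/(1−xy) − 1/(1−x²y²)]` (the even part of `ζ(2)`). [folklore] -/
def M2rep : KZ.IntegralRep 2 :=
  ⟨cube2, fun x => fC2 x - T2rep.integrand x, isSemialgebraic_openUnitCube,
    IsSemialgebraicFunOn.sub_holds isSemialgebraicFunOn_fC2 T2rep.isSemialgebraicFunOn_integrand,
    integrableOn_fC2.sub T2rep.integrableOn⟩

/-- `[□², 1/(1−xy)] − [□², 1/(1−x²y²)] − [□², xy/(1−x²y²)]`: ONE integrand additivity. [folklore] -/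
theorem C2cube_split_mem : KZ.of C2cube - KZ.of T2rep - KZ.of M2rep ∈ KZ.integrandAddRel :=
  ⟨2, C2cube, T2rep, M2rep, rfl, rfl, fun x _ => by simp [M2rep, C2cube], rfl⟩

/-- The squaring map `(x,y) ↦ (x², y²)`. [folklore] -/
def sqMap (x : Fin 2 → ℝ) : Fin 2 → ℝ := ![x 0 * x 0, x 1 * x 1]

/-- Its derivative `diag(2x₀, 2x₁)`. [folklore] -/
def sqDeriv (x : Fin 2 → ℝ) : (Fin 2 → ℝ) →L[ℝ] (Fin 2 → ℝ) :=
  LinearMap.toContinuousLinearMap (Matrix.toLin' !![2 * x 0, 0; 0, 2 * x 1])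

/-- The determinant of `sqDeriv`. [folklore] -/
theorem det_sqDeriv (x : Fin 2 → ℝ) : (sqDeriv x).det = 4 * x 0 * x 1 := by
  have h : (!![2 * x 0, 0; 0, 2 * x 1] : Matrix (Fin 2) (Fin 2) ℝ).det = 4 * x 0 * x 1 := by
    simp [Matrix.det_fin_two]; ring
  rw [← h]; exact LinearMap.det_toLin' _

/-- Differentiability of `sqMap` with the stated derivative. [folklore] -/
theorem hasFDerivAt_sqMap (x : Fin 2 → ℝ) : HasFDerivAt sqMap (sqDeriv x) x := by
  have p0 : HasFDerivAt (fun y : Fin 2 → ℝ => y 0)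
      (ContinuousLinearMap.proj (R := ℝ) (φ := fun _ : Fin 2 => ℝ) 0) x := hasFDerivAt_apply 0 x
  have p1 : HasFDerivAt (fun y : Fin 2 → ℝ => y 1)
      (ContinuousLinearMap.proj (R := ℝ) (φ := fun _ : Fin 2 => ℝ) 1) x := hasFDerivAt_apply 1 x
  have c0 : HasFDerivAt (fun y : Fin 2 → ℝ => sqMap y 0) ((ContinuousLinearMap.proj 0).comp (sqDeriv x)) x := by
    refine (p0.mul p0).congr_fderiv ?_
    ext v; simp [sqDeriv, dotProduct, Fin.sum_univ_two]; ring
  have c1 : HasFDerivAt (fun y : Fin 2 → ℝ => sqMap y 1) ((ContinuousLinearMap.proj 1).comp (sqDeriv x)) x := by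
    refine (p1.mul p1).congr_fderiv ?_
    ext v; simp [sqDeriv, dotProduct, Fin.sum_univ_two]; ring
  rw [hasFDerivAt_pi']
  intro i; fin_cases i
  · exact c0
  · exact c1

/-- `sqMap` is injective on its domain. [folklore] -/
theorem injOn_sqMap : InjOn sqMap cube2 := by
  intro x hx y hy h
  obtain ⟨⟨a0, -⟩, ⟨b0, -⟩⟩ := mem_cube2.mp hx
  obtain ⟨⟨a0', -⟩, ⟨b0', -⟩⟩ := mem_cube2.mp hy
  have e0 : x 0 * x 0 = y 0 * y 0 := by simpa [sqMap] using congrFun h 0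
  have e1 : x 1 * x 1 = y 1 * y 1 := by simpa [sqMap] using congrFun h 1
  funext i; fin_cases i
  · show x 0 = y 0; nlinarith
  · show x 1 = y 1; nlinarith

/-- The image of the domain under `sqMap`. [folklore] -/
theorem image_sqMap : sqMap '' cube2 = cube2 := by
  apply Subset.antisymm
  · rintro _ ⟨x, hx, rfl⟩
    obtain ⟨⟨a0, a1⟩, ⟨b0, b1⟩⟩ := mem_cube2.mp hx
    rw [mem_cube2]
    simp only [sqMap, Matrix.cons_val_zero, Matrix.cons_val_one]
    exact ⟨⟨by positivity, by nlinarith⟩, ⟨by positivity, by nlinarith⟩⟩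
  · intro w hw
    obtain ⟨⟨a0, a1⟩, ⟨b0, b1⟩⟩ := mem_cube2.mp hw
    refine ⟨![Real.sqrt (w 0), Real.sqrt (w 1)], ?_, ?_⟩
    · rw [mem_cube2]
      simp only [Matrix.cons_val_zero, Matrix.cons_val_one]
      exact ⟨⟨Real.sqrt_pos.mpr a0, (Real.sqrt_lt' one_pos).mpr (by simpa using a1)⟩,
        ⟨Real.sqrt_pos.mpr b0, (Real.sqrt_lt' one_pos).mpr (by simpa using b1)⟩⟩
    · funext i; fin_cases i
      · simp [sqMap, Real.mul_self_sqrt a0.le]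
      · simp [sqMap, Real.mul_self_sqrt b0.le]

/-- `sqMap` is a `ℚ`-semialgebraic map on its domain (rational or polynomial components). [folklore] -/
theorem isSemialgebraicMapOn_sqMap : IsSemialgebraicMapOn ℚ cube2 sqMap := by
  have h := isSemialgebraicMapOn_aeval (isSemialgebraic_openUnitCube (d := 2))
    (![X 0 * X 0, X 1 * X 1] : Fin 2 → MvPolynomial (Fin 2) ℚ)
  refine h.congr fun x _ => ?_
  funext j; fin_cases j <;> simp [sqMap]

/-- `¼` is algebraic. [folklore] -/
theorem isAlgebraic_quarter : IsAlgebraic ℚ ((1 / 4 : ℚ) : ℝ) := isAlgebraic_algebraMap _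

/-- `[□², ¼ · 1/(1−xy)]`. [folklore] -/
def C2q : KZ.IntegralRep 2 := C2cube.constMul ((1 / 4 : ℚ) : ℝ) isAlgebraic_quarter

/-- **The even part is a quarter of `ζ(2)`, by ONE change of variables** `(x,y) ↦ (x²,y²)`. [folklore] -/
theorem M2rep_sub_C2q_mem_cov : KZ.of M2rep - KZ.of C2q ∈ KZ.changeOfVariablesRel := by
  refine ⟨2, M2rep, C2q, sqMap, fun x => sqDeriv x, isSemialgebraicMapOn_sqMap,
    fun x _ => (hasFDerivAt_sqMap x).hasFDerivWithinAt, injOn_sqMap, image_sqMap.symm, fun x hx => ?_, rfl⟩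
  obtain ⟨a0, a1, b0, b1, p, p2⟩ := cube2_facts hx
  rw [det_sqDeriv, abs_of_pos (by positivity)]
  change fC2 x - 1 / (1 - x 0 ^ 2 * x 1 ^ 2) = ((1 / 4 : ℚ) : ℝ) * fC2 (sqMap x) * (4 * x 0 * x 1)
  simp only [fC2, sqMap, Matrix.cons_val_zero, Matrix.cons_val_one]
  have : (1 : ℝ) - x 0 * x 1 ≠ 0 := by linarith
  have : (1 : ℝ) - x 0 ^ 2 * x 1 ^ 2 ≠ 0 := by linarith
  have : (1 : ℝ) - x 0 * x 0 * (x 1 * x 1) ≠ 0 := by nlinarith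
  push_cast
  field_simp
  ring

/-- `4 · [□², ¼ f] ≡ [□², f]`. [folklore] -/
theorem four_C2q_sub_C2cube_mem : 4 • KZ.of C2q - KZ.of C2cube ∈ KZ.relations := by
  have h1 := scale_nat_sub_nsmul_mem 4 (KZ.of C2q)
  rw [KZ.scale_of] at h1
  have h2 : KZ.of ((C2q).constMul ((4 : ℕ) : ℝ) (isAlgebraic_natCast 4)) - KZ.of C2cube ∈ KZ.relations :=
    of_sub_of_mem_relations_of_eqOn rfl fun x _ => by
      simp only [KZ.IntegralRep.integrand_constMul, C2q]; push_cast; ring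
  have : 4 • KZ.of C2q - KZ.of C2cube = -(KZ.of ((C2q).constMul ((4 : ℕ) : ℝ) (isAlgebraic_natCast 4)) -
      4 • KZ.of C2q) + (KZ.of ((C2q).constMul ((4 : ℕ) : ℝ) (isAlgebraic_natCast 4)) - KZ.of C2cube) := by abel
  rw [this]
  exact add_mem (neg_mem h1) h2

/-- **`3·[ζ(2)] ≡ 2·Q²`** — Euler's `ζ(2) = π²/6` as a statement inside the calculus
(`Q² = (π/2)²`): `3 • [Δ₂, ω₀₁] − 2 • [Q²] ∈ KZ.relations`. [folklore] -/
theorem three_zeta_two_sub_two_G2_mem : 3 • KZ.of (wordRep ω2 1 adm_ω2) - 2 • KZ.of G2 ∈ KZ.relations := by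
  have h1 := KZ.changeOfVariablesRel_subset_relations C2cube_sub_mem_cov
  have h2 := KZ.integrandAddRel_subset_relations C2cube_split_mem
  have h3 := KZ.changeOfVariablesRel_subset_relations M2rep_sub_C2q_mem_cov
  have h4 := four_C2q_sub_C2cube_mem
  have h5 := of_G2_sub_two_T2rep_mem
  -- −3(C−W) + 4(C−T−M) + 4(M−q) + (4q−C) − 2(G−2T) = 3W − 2G
  have : 3 • KZ.of (wordRep ω2 1 adm_ω2) - 2 • KZ.of G2 =
      -(3 • (KZ.of C2cube - KZ.of (wordRep ω2 1 adm_ω2))) + 4 • (KZ.of C2cube - KZ.of T2rep - KZ.of M2rep)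
      + 4 • (KZ.of M2rep - KZ.of C2q) + (4 • KZ.of C2q - KZ.of C2cube) - 2 • (KZ.of G2 - 2 • KZ.of T2rep) := by
    abel
  rw [this]
  exact sub_mem (add_mem (add_mem (add_mem (neg_mem (KZ.relations.nsmul_mem h1 3))
    (KZ.relations.nsmul_mem h2 4)) (KZ.relations.nsmul_mem h3 4)) h4) (KZ.relations.nsmul_mem h5 2)

end Summit.KontsevichZagierPeriods.MzvKernelInKZ.Negative
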